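import Mathlib
import HarnessLib
import Summits.AtomisticToContinuum.FouriersLaw.Theses.KineticCorner

/-!
# Stub TG `stub_targetGlue` of line `Sketch`, crux `EmbeddedDrudeMourre.DrudeDissolution`
(stmt-AtomisticToContinuum-12593): the glue of the kinetic-corner deliverable

`Summit.AtomisticToContinuum.FouriersLaw.Theses.KineticCorner.TargetGlue` verbatim
(item stmt-AtomisticToContinuum-3436 of route `KineticCorner`):
`PostKineticTail → KineticLimit → StationaryCorrelationBound → GoodFamilyExists → KineticCornerGreenKubo`.

Pure real analysis (dominated tiling of `(0, ∞)`). Fix `ω₂ lam β γ > 0`; `KineticLimit` gives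
`K ∈ L¹(0,∞)` with `c := ∫₀^∞ K > 0` and the window clause; `StationaryCorrelationBound` gives
`|C_T(t)| ≤ B T²` (`t ≥ 0`, `T < T₁`). For `e > 0` put `e' := min e (c/2)` and choose `δ > 0` with
`max B 1 · δ ≤ e'/4` and `∫_{(0,δ]} |K| ≤ e'/8` (absolute continuity of the integral, via
`tendsto_setIntegral_of_antitone` on `(0, 1/(n+1)]`), `(M₀, T₀')` from `PostKineticTail` with `e'/4`,
`M ≥ max M₀ δ` with `∫_{(M,∞)} |K| ≤ e'/8` (tail of an `L¹` function, same lemma on `(n, ∞)`), `T₀''`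
from the window clause with `(δ, M, e'/4)`, and `T₁ := min (min T₀' T₀'') T₁(bound)`. For a good
triple with `T < T₁`: `C_T ∈ L¹(0,∞)` (`(0,∞) ⊆ [0, M T⁻²] ∪ (M₀ T⁻², ∞)`), and splitting
`∫₀^∞ C_T` over `(0, δT⁻²]` (`≤ max B 1 · δ ≤ e'/4`), `(δT⁻², MT⁻²]` (the interval integral, within
`e'/4` of `∫_δ^M K`, itself within `e'/4` of `c`) and `(MT⁻², ∞)` (`≤ e'/4`) gives
`|∫₀^∞ C_T − c| ≤ e' ≤ e`, whence `∫₀^∞ C_T ≥ c/2 > 0`, `T² κ_GK = ∫₀^∞ C_T` and `HasGreenKubo`.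
Clause (i) of the target follows from clause (ii) (with `e := c`) and `GoodFamilyExists`.

## Contents
* `targetGlue_exists_head_le`, `targetGlue_exists_tail_le` — small head / tail of `∫ |K|` for
  `K ∈ L¹(0,∞)`;
* `targetGlue_setIntegral_Ioi_eq_add_three` — `∫_{(0,∞)} = ∫_{(0,a]} + ∫_{(a,b]} + ∫_{(b,∞)}`;
* `targetGlue_window_close` — `|∫_δ^M K − ∫₀^∞ K| ≤ head + tail`;
* `targetGlue_tiling` — the dominated tiling estimate for one good triple;
* `targetGlue_assembly` — trivial logic: clause (ii) and (ii) ⇒ (i) give the target shape;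
* `stub_targetGlue` — the registered stub, verbatim.
-/

noncomputable section

open MeasureTheory Filter Set
open scoped Topology

namespace Summit.AtomisticToContinuum.FouriersLaw.Theorems.DrudeDissolution.LineSketch

open Literature.MathematicalPhysics.KineticTheory.HeatConduction
open Summit.AtomisticToContinuum.FouriersLaw.Theses.KineticCorner

/-- Small head of an `L¹(0,∞)` function: `∫_{(0,δ]} |K| ≤ ε` for all `δ ≤ δ₀`
(absolute continuity of the integral on the shrinking sets `(0, 1/(n+1)]`). [folklore] -/
theorem targetGlue_exists_head_le {K : ℝ → ℝ} (hK : IntegrableOn K (Ioi 0)) {ε : ℝ}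
    (hε : 0 < ε) : ∃ δ₀ : ℝ, 0 < δ₀ ∧ ∀ δ : ℝ, δ ≤ δ₀ → ∫ x in Ioc 0 δ, |K x| ≤ ε := by
  have htend : Tendsto (fun n : ℕ => ∫ x in Ioc (0 : ℝ) (1 / ((n : ℝ) + 1)), |K x|) atTop
      (𝓝 (∫ x in ⋂ n : ℕ, Ioc (0 : ℝ) (1 / ((n : ℝ) + 1)), |K x|)) := by
    apply tendsto_setIntegral_of_antitone (fun n => measurableSet_Ioc)
    · intro m n hmn
      exact Ioc_subset_Ioc le_rfl
        (one_div_le_one_div_of_le (by positivity) (by exact_mod_cast Nat.add_le_add_right hmn 1))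
    · exact ⟨0, (hK.mono_set Ioc_subset_Ioi_self).abs⟩
  have hempty : (⋂ n : ℕ, Ioc (0 : ℝ) (1 / ((n : ℝ) + 1))) = ∅ := by
    ext x
    simp only [mem_iInter, mem_empty_iff_false, iff_false]
    intro hx
    obtain ⟨n, hn⟩ := exists_nat_one_div_lt (hx 0).1
    exact lt_irrefl x ((hx n).2.trans_lt hn)
  simp only [hempty, Measure.restrict_empty, integral_zero_measure] at htend
  obtain ⟨n, hn⟩ := (htend.eventually (ge_mem_nhds hε)).exists
  refine ⟨1 / ((n : ℝ) + 1), by positivity, fun δ hδ => ?_⟩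
  calc ∫ x in Ioc 0 δ, |K x| ≤ ∫ x in Ioc (0 : ℝ) (1 / ((n : ℝ) + 1)), |K x| :=
        setIntegral_mono_set (hK.mono_set Ioc_subset_Ioi_self).abs
          (Eventually.of_forall fun x => abs_nonneg (K x))
          (Eventually.of_forall (Ioc_subset_Ioc_right hδ))
    _ ≤ ε := hn

/-- Small tail of an `L¹(0,∞)` function: some `M ≥ M₀` has `∫_{(M,∞)} |K| ≤ ε`
(the shrinking sets `(n, ∞)` have empty intersection). [folklore] -/
theorem targetGlue_exists_tail_le {K : ℝ → ℝ} (hK : IntegrableOn K (Ioi 0)) {ε : ℝ}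
    (hε : 0 < ε) (M₀ : ℝ) : ∃ M : ℝ, M₀ ≤ M ∧ ∫ x in Ioi M, |K x| ≤ ε := by
  have htend : Tendsto (fun n : ℕ => ∫ x in Ioi (n : ℝ), |K x|) atTop
      (𝓝 (∫ x in ⋂ n : ℕ, Ioi (n : ℝ), |K x|)) := by
    apply tendsto_setIntegral_of_antitone (fun n => measurableSet_Ioi)
    · intro m n hmn
      exact Ioi_subset_Ioi (by exact_mod_cast hmn)
    · refine ⟨0, ?_⟩
      rw [Nat.cast_zero]
      exact hK.abs
  have hempty : (⋂ n : ℕ, Ioi (n : ℝ)) = ∅ := by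
    ext x
    simp only [mem_iInter, mem_Ioi, mem_empty_iff_false, iff_false, not_forall, not_lt]
    exact exists_nat_ge x
  simp only [hempty, Measure.restrict_empty, integral_zero_measure] at htend
  obtain ⟨n, hn, hn'⟩ :=
    ((htend.eventually (ge_mem_nhds hε)).and (eventually_ge_atTop ⌈M₀⌉₊)).exists
  exact ⟨n, (Nat.le_ceil M₀).trans (by exact_mod_cast hn'), hn⟩

/-- Tiling `(0,∞) = (0,a] ∪ (a,b] ∪ (b,∞)` of the integral of an `L¹(0,∞)` function,
`0 ≤ a ≤ b`. [folklore] -/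
theorem targetGlue_setIntegral_Ioi_eq_add_three {f : ℝ → ℝ} (hf : IntegrableOn f (Ioi 0))
    {a b : ℝ} (ha : 0 ≤ a) (hab : a ≤ b) :
    ∫ t in Ioi 0, f t = (∫ t in Ioc 0 a, f t) + (∫ t in Ioc a b, f t) + ∫ t in Ioi b, f t := by
  have hI1 : IntegrableOn f (Ioc 0 a) := hf.mono_set Ioc_subset_Ioi_self
  have hIa : IntegrableOn f (Ioi a) := hf.mono_set (Ioi_subset_Ioi ha)
  have hI2 : IntegrableOn f (Ioc a b) := hIa.mono_set Ioc_subset_Ioi_self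
  have hI3 : IntegrableOn f (Ioi b) := hIa.mono_set (Ioi_subset_Ioi hab)
  rw [add_assoc, ← setIntegral_union (Ioc_disjoint_Ioi le_rfl) measurableSet_Ioi hI2 hI3,
    Ioc_union_Ioi_eq_Ioi hab, ← setIntegral_union (Ioc_disjoint_Ioi le_rfl) measurableSet_Ioi hI1 hIa,
    Ioc_union_Ioi_eq_Ioi ha]

/-- The window integral `∫_δ^M K` is within head + tail of `∫₀^∞ K`. [folklore] -/
theorem targetGlue_window_close {K : ℝ → ℝ} (hK : IntegrableOn K (Ioi 0)) {δ M ε₁ ε₂ : ℝ}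
    (hδ : 0 < δ) (hδM : δ ≤ M) (hhead : ∫ x in Ioc 0 δ, |K x| ≤ ε₁)
    (htail : ∫ x in Ioi M, |K x| ≤ ε₂) :
    |(∫ τ in δ..M, K τ) - ∫ τ in Ioi 0, K τ| ≤ ε₁ + ε₂ := by
  have h1 : |∫ τ in Ioc 0 δ, K τ| ≤ ε₁ := abs_integral_le_integral_abs.trans hhead
  have h3 : |∫ τ in Ioi M, K τ| ≤ ε₂ := abs_integral_le_integral_abs.trans htail
  rw [intervalIntegral.integral_of_le hδM, targetGlue_setIntegral_Ioi_eq_add_three hK hδ.le hδM,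
    abs_le]
  obtain ⟨h1l, h1u⟩ := abs_le.1 h1
  obtain ⟨h3l, h3u⟩ := abs_le.1 h3
  constructor <;> linarith

/-- **Dominated tiling estimate** for one good triple (the analytic heart of `TargetGlue`): local
integrability on `[0, M T⁻²]` and the post-kinetic tail give `C ∈ L¹(0,∞)`; the initial layer
`(0, δT⁻²]` carries at most `B δ`, the kinetic window `(δT⁻², MT⁻²]` is the interval integral
(within `e/4` of `∫_δ^M K`, itself within `e/4` of `c`), the far tail at most `e/4`. [folklore] -/
theorem targetGlue_tiling {C K : ℝ → ℝ} {T δ M M₀ B e c : ℝ} (hT : 0 < T) (hδ : 0 < δ)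
    (hM₀M : M₀ ≤ M) (hδM : δ ≤ M)
    (hloc : ∀ S : ℝ, IntegrableOn C (Icc 0 S))
    (htailInt : IntegrableOn C (Ioi (M₀ / T ^ 2)))
    (htail : ∫ t in Ioi (M₀ / T ^ 2), |C t| ≤ e / 4)
    (hbound : ∀ t : ℝ, 0 ≤ t → |C t| ≤ B * T ^ 2)
    (hBδ : B * δ ≤ e / 4)
    (hwin : |(∫ t in (δ / T ^ 2)..(M / T ^ 2), C t) - ∫ τ in δ..M, K τ| ≤ e / 4)
    (hKwin : |(∫ τ in δ..M, K τ) - c| ≤ e / 4) :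
    IntegrableOn C (Ioi 0) ∧ |(∫ t in Ioi 0, C t) - c| ≤ e := by
  have hT2 : 0 < T ^ 2 := by positivity
  have ha0 : 0 < δ / T ^ 2 := div_pos hδ hT2
  have hab : δ / T ^ 2 ≤ M / T ^ 2 := div_le_div_of_nonneg_right hδM hT2.le
  have hb0 : M₀ / T ^ 2 ≤ M / T ^ 2 := div_le_div_of_nonneg_right hM₀M hT2.le
  -- (1) integrability on `(0, ∞)`
  have hInt : IntegrableOn C (Ioi 0) := by
    refine ((hloc (M / T ^ 2)).union htailInt).mono_set fun t ht => ?_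
    by_cases htb : t ≤ M / T ^ 2
    · exact Or.inl (mem_Icc.2 ⟨le_of_lt (mem_Ioi.1 ht), htb⟩)
    · exact Or.inr (mem_Ioi.2 (hb0.trans_lt (lt_of_not_ge htb)))
  refine ⟨hInt, ?_⟩
  -- (2) the three pieces
  have hb1 : |∫ t in Ioc 0 (δ / T ^ 2), C t| ≤ e / 4 := by
    have h := norm_setIntegral_le_of_norm_le_const (μ := volume) (s := Ioc 0 (δ / T ^ 2)) (f := C)
      (C := B * T ^ 2) measure_Ioc_lt_top
      (fun t ht => by rw [Real.norm_eq_abs]; exact hbound t ht.1.le)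
    rw [Real.norm_eq_abs, Real.volume_real_Ioc_of_le ha0.le, sub_zero] at h
    calc |∫ t in Ioc 0 (δ / T ^ 2), C t| ≤ B * T ^ 2 * (δ / T ^ 2) := h
      _ = B * δ := by field_simp
      _ ≤ e / 4 := hBδ
  have hb2 : |(∫ t in Ioc (δ / T ^ 2) (M / T ^ 2), C t) - ∫ τ in δ..M, K τ| ≤ e / 4 := by
    rw [← intervalIntegral.integral_of_le hab]; exact hwin
  have hb3 : |∫ t in Ioi (M / T ^ 2), C t| ≤ e / 4 := by
    calc |∫ t in Ioi (M / T ^ 2), C t| ≤ ∫ t in Ioi (M / T ^ 2), |C t| :=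
          abs_integral_le_integral_abs
      _ ≤ ∫ t in Ioi (M₀ / T ^ 2), |C t| :=
          setIntegral_mono_set htailInt.abs (Eventually.of_forall fun t => abs_nonneg (C t))
            (Eventually.of_forall (Ioi_subset_Ioi hb0))
      _ ≤ e / 4 := htail
  -- (3) triangle inequality
  rw [targetGlue_setIntegral_Ioi_eq_add_three hInt ha0.le hab, abs_le]
  obtain ⟨h1l, h1u⟩ := abs_le.1 hb1
  obtain ⟨h2l, h2u⟩ := abs_le.1 hb2
  obtain ⟨h3l, h3u⟩ := abs_le.1 hb3
  obtain ⟨h4l, h4u⟩ := abs_le.1 hKwin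
  constructor <;> linarith

/-- Trivial logic of the target shape: clause (ii) and "(ii) ⇒ (i)" assemble
`∃ T₀, 0 < c ∧ 0 < T₀ ∧ (i) ∧ (ii)`. [folklore] -/
theorem targetGlue_assembly {c : ℝ} {P : ℝ → Prop} {Q : Prop} (hc : 0 < c) (hQ : Q)
    (hPQ : Q → ∃ T₀ : ℝ, 0 < T₀ ∧ P T₀) : ∃ T₀ : ℝ, 0 < c ∧ 0 < T₀ ∧ P T₀ ∧ Q := by
  obtain ⟨T₀, hT₀, hP⟩ := hPQ hQ
  exact ⟨T₀, hc, hT₀, hP, hQ⟩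

/-- **TG `stub_targetGlue`** (registered stub of line `Sketch`, crux
`EmbeddedDrudeMourre.DrudeDissolution`; = item stmt-AtomisticToContinuum-3436 of route
`KineticCorner`, verbatim): `PostKineticTail → KineticLimit → StationaryCorrelationBound →
GoodFamilyExists → KineticCornerGreenKubo`. Proof: the dominated tiling `targetGlue_tiling` with the
parameters chosen as in the module docstring gives clause (ii) with `c := ∫₀^∞ K`; clause (i) is
clause (ii) at `e := c` applied to the good triple of `GoodFamilyExists`. [folklore] -/
theorem stub_targetGlue : Summit.AtomisticToContinuum.FouriersLaw.Theses.KineticCorner.TargetGlue := by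
  intro hPKT hKL hSCB hGFE ω₂ lam β γ hω hl hβ hγ
  obtain ⟨K, hKint, hc, hwin⟩ := hKL ω₂ lam β γ hω hl hβ hγ
  obtain ⟨B, T₁b, hT₁b, hSCB'⟩ := hSCB ω₂ lam β γ hω hl hβ hγ
  refine ⟨∫ τ in Ioi 0, K τ, targetGlue_assembly hc ?_ ?_⟩
  · -- clause (ii): the Aoki–Lukkarinen–Spohn law on the corner
    intro e he
    obtain ⟨e', he'pos, he'e, he'c⟩ : ∃ e' : ℝ, 0 < e' ∧ e' ≤ e ∧ e' ≤ (∫ τ in Ioi 0, K τ) / 2 :=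
      ⟨min e ((∫ τ in Ioi 0, K τ) / 2), lt_min he (half_pos hc), min_le_left _ _, min_le_right _ _⟩
    obtain ⟨Bp, hBp, hBBp⟩ : ∃ Bp : ℝ, 0 < Bp ∧ B ≤ Bp :=
      ⟨max B 1, lt_max_of_lt_right one_pos, le_max_left _ _⟩
    -- initial layer width `δ`
    obtain ⟨δ₀, hδ₀, hhead⟩ := targetGlue_exists_head_le hKint (ε := e' / 8) (by positivity)
    obtain ⟨δ, hδpos, hδδ₀, hδB⟩ : ∃ δ : ℝ, 0 < δ ∧ δ ≤ δ₀ ∧ δ ≤ e' / (4 * Bp) :=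
      ⟨min δ₀ (e' / (4 * Bp)), lt_min hδ₀ (by positivity), min_le_left _ _, min_le_right _ _⟩
    have hBδ : Bp * δ ≤ e' / 4 := by
      have h := (le_div_iff₀ (by positivity : (0 : ℝ) < 4 * Bp)).1 hδB
      linarith
    have hheadδ : ∫ x in Ioc 0 δ, |K x| ≤ e' / 8 := hhead δ hδδ₀
    -- post-kinetic tail with `e'/4`
    obtain ⟨M₀, T₀', _, hT₀', hPKT'⟩ := hPKT ω₂ lam β γ hω hl hβ hγ (e' / 4) (by positivity)
    -- kinetic multiple `M`
    obtain ⟨M, hMge, htailK⟩ := targetGlue_exists_tail_le hKint (ε := e' / 8) (by positivity)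
      (max M₀ δ)
    have hM₀M : M₀ ≤ M := (le_max_left _ _).trans hMge
    have hδM : δ ≤ M := (le_max_right _ _).trans hMge
    -- window clause with `(δ, M, e'/4)`
    obtain ⟨T₀'', hT₀'', hwin'⟩ := hwin δ M (e' / 4) hδpos hδM (by positivity)
    have hKwin : |(∫ τ in δ..M, K τ) - ∫ τ in Ioi 0, K τ| ≤ e' / 4 := by
      have h := targetGlue_window_close hKint hδpos hδM hheadδ htailK
      linarith
    refine ⟨min (min T₀' T₀'') T₁b, lt_min (lt_min hT₀' hT₀'') hT₁b, ?_⟩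
    intro T μ D hT hTlt hgood
    have hT1 : T < T₀' := hTlt.trans_le ((min_le_left _ _).trans (min_le_left _ _))
    have hT2 : T < T₀'' := hTlt.trans_le ((min_le_left _ _).trans (min_le_right _ _))
    have hT3 : T < T₁b := hTlt.trans_le (min_le_right _ _)
    have hT2pos : 0 < T ^ 2 := by positivity
    obtain ⟨htailInt, htailC⟩ := hPKT' T μ D hT hT1 hgood
    have hwinC := hwin' T μ D hT hT2 hgood
    have hbd : ∀ t : ℝ, 0 ≤ t → |D.currentCorrelation μ t| ≤ Bp * T ^ 2 := fun t ht =>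
      (hSCB' T μ D hT hT3 hgood t ht).trans (mul_le_mul_of_nonneg_right hBBp hT2pos.le)
    obtain ⟨hInt, hclose⟩ := targetGlue_tiling hT hδpos hM₀M hδM hgood.2.2.2.1 htailInt htailC
      hbd hBδ hwinC hKwin
    have hGK : T ^ 2 * D.greenKuboConductivity μ T = ∫ t in Ioi 0, D.currentCorrelation μ t := by
      simp only [InfiniteChainDynamics.greenKuboConductivity]
      rw [← mul_assoc, mul_inv_cancel₀ hT2pos.ne', one_mul]
    have hIpos : 0 < ∫ t in Ioi 0, D.currentCorrelation μ t := by
      have h := (abs_le.1 hclose).1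
      linarith
    refine ⟨⟨hgood.2.2.1, hInt, ?_⟩, ?_⟩
    · show 0 < D.greenKuboConductivity μ T
      simp only [InfiniteChainDynamics.greenKuboConductivity]
      exact mul_pos (inv_pos.2 hT2pos) hIpos
    · rw [hGK]
      exact hclose.trans he'e
  · -- clause (i) from clause (ii) (with `e := c`) and `GoodFamilyExists`
    intro hii
    obtain ⟨T₀, hT₀, h⟩ := hii (∫ τ in Ioi 0, K τ) hc
    refine ⟨T₀, hT₀, fun T hT hTlt => ?_⟩
    obtain ⟨μ, D, hgood⟩ := hGFE ω₂ lam β γ hω hl hβ hγ T hT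
    exact ⟨μ, hgood.1, D, hgood.2.1, (h T μ D hT hTlt hgood).1⟩

end Summit.AtomisticToContinuum.FouriersLaw.Theorems.DrudeDissolution.LineSketch

end
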